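import Literature.Analysis.FluidPDE.Vorticity
import Literature.Analysis.FluidPDE.LerayHopf
import HarnessLib

/-!
# Localized vorticity-magnitude criteria and a critical class weighted by the coherence of the
# vorticity direction (Grujić–Guberović 2010, Theorems 1 and 2)

Topic `Analysis/FluidPDE`. Source: Z. Grujić, R. Guberović, *Localization of analytic regularity
criteria on the vorticity and balance between the vorticity magnitude and coherence of the
vorticity direction in the 3D NSE*, Comm. Math. Phys. **298** (2010) 407–418 [GrujicGuberovic2010]
(held, lit key `paper:doi-10-1007-s00220-010-1000-4`; read: §1 (2)–(7) pp. 408–410, Remark 1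
p. 411, §3 **Theorem 1** p. 413, §4 **Theorem 2** p. 415 with its proof pp. 415–417).

The second part of this paper is the printed member of the Constantin–Fefferman family in which
"coherence of the vorticity direction serves as a WEIGHT in the space-time integrability of the
vorticity magnitude" (p. 410): the local, scaling-invariant classes
`∫ (∫_{B(x₀,2R)} |ω|^α ρ_{γ,2R}^α dx)^δ dt < ∞`, `δ = 2/((2+γ)α − 3)`, `ρ_{γ,r}(x,t) = sup_{y ∈
B(x,r), y ≠ x} |sin φ(ξ(x,t), ξ(y,t))|/|x − y|^γ`, whose end-point `γ = ½, α = 2, δ = 1` improves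
the `½`-Hölder coherence criterion (Beirão da Veiga–Berselli 2002 / Grujić 2009: tree
`holderHalf_direction_criterion` PROVED, `grujic2009_localized_halfHolder_coherence` fact). It is
the nearest print to the "weighted direction budget" hypothesis class of the NavierStokesRegularity
tribunal's separating-rung map for route ScaledTopAlignment (row 10 there names only Chae 2007's
unweighted Triebel–Lizorkin class). The first part localizes Beirão da Veiga's vorticity-magnitude
classes `‖ω‖_{L^q}^{2q/(2q−3)} ∈ L¹_t`, `3 ≤ q < ∞` (tree, global: `BeiraoDaVeiga1995_vorticityCriterion`
PROVED) and the BKM criterion to a parabolic cylinder. No decl stated either theorem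
(`lean search 'GrujicGuberovic|coherenceQuotient|Guberovic2010'`, 2026-08-26: the bib key is cited
by the thesis `DirectionEnergy` only; `guberovic2010_analyticity_radius` is a different paper).

No regularity claim about Navier–Stokes is made by this file beyond the printed theorems, recorded
as named facts (`def … : Prop`, cite-tagged, unproved here).

## What is printed (verbatim up to notation; `ν = 1`)

P. 410: "Denote by `η` the vorticity direction. Let `(x, t)` be a spatio-temporal point, `r > 0` and
`0 < γ < 1`. A `γ`-Hölder measure of coherence of the vorticity direction at `(x, t)` is then given
by `ρ_{γ,r}(x, t) = sup_{y ∈ B(x,r), y ≠ x} |sin φ(η(x, t), η(y, t))| / |x − y|^γ`. For a given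
point `(x₀, t₀)` and `α, δ > 0`, the class under consideration is defined by requiring finiteness
of `∫_{t₀−(2r)²}^{t₀} (∫_{B(x₀,2r)} |ω(x, t)|^α ρ^α_{γ,2r}(x, t) dx)^δ dt` (5). It will transpire
in the proof that `δ = 2/((2 + γ)α − 3)` (6) … the condition (6) makes the class (5) scaling
invariant (critical). The case `γ = ½`, `α = 2` and `δ = 1` … is included (and is an improvement
over the `½`-Hölder coherence)."

**Theorem 1** (p. 413). "Let `u` be a Leray solution on a space-time domain `Ω × (0, T)`, `(x₀, t₀)`
in `Ω × (0, T)` and `0 < R < 1` such that the parabolic cylinder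
`Q_{2R}(x₀, t₀) = B(x₀, 2R) × (t₀ − (2R)², t₀)` is contained in `Ω × (0, T)`. Suppose that `u` is
smooth in `Q_{2R}(x₀, t₀)` and `‖ω‖_{L^q(B(x₀,2R))}^{2q/(2q−3)}` is in `L¹(t₀ − (2R)², t₀)` for some
`3 ≤ q ≤ ∞`. Then the localized enstrophy remains uniformly bounded up to `t = t₀`, i.e.,
`sup_{t ∈ (t₀−R², t₀)} ∫_{B(x₀,R)} |ω(x, t)|² dx < ∞`."

**Theorem 2** (p. 415). "Let `u` be a Leray solution on a space-time domain `Ω × (0, T)`, `(x₀, t₀)`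
in `Ω × (0, T)` and `0 < R < 1` such that … `Q_{2R}(x₀, t₀)` … is contained in `Ω × (0, T)`. Let
`0 < γ < 1`, `α < 3/γ`, `α > 3/(γ + 2)` and `δ = 2/((2 + γ)α − 3)` (the scaling invariance). Suppose
that `u` is smooth in `Q_{2R}(x₀, t₀)` and `∫_{t₀−(2R)²}^{t₀} (∫_{B(x₀,2R)} |ω(x, t)|^α
ρ^α_{γ,2R}(x, t) dx)^δ dt` is finite. Then the localized enstrophy remains uniformly bounded up to
`t = t₀`, i.e., `sup_{t ∈ (t₀−R², t₀)} ∫_{B(x₀,R)} |ω(x, t)|² dx < ∞`."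
(Leray solution: "weak (distributional) solution satisfying `u ∈ L^∞(0,T; L²) ∩ L²(0,T; H¹)`",
as in Grujić 2009; Remark 1 p. 411: local Leray solutions in the sense of Lemarié-Rieusset would do.)

## Transcription into the tree's vocabulary (frame of `grujic2009_localized_halfHolder_coherence`)

* `ℝ³ = EuclideanSpace ℝ (Fin 3)`, time first, `ν = 1` as printed, `Ω = ℝ³`: `u` Leray–Hopf on
  `[0, T)` from `u₀` (`IsLerayHopfOn T 1 0 u₀ u`), `0 < R < 1`, `(2R)² ≤ t₀ < T`; `ω = curl (u t)`,
  `ξ = vorticityDirection (curl (u t))`; "`u` smooth in `Q_{2R}`" = `ContDiffOn ℝ ⊤ (uncurry u)` on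
  the open cylinder; conclusion `∃ C, ∀ t ∈ (t₀−R², t₀), ∫_{B(x₀,R)} ‖curl (u t) x‖² dx ≤ C`.
* `ρ_{γ,r}` is `GrujicGuberovic2010.coherenceQuotient` (`ℝ≥0∞`-valued supremum), with the sine
  rendered sign-blindly as `‖ξ(x,t) × ξ(y,t)‖` (`= |sin φ|` for unit vectors; `0` at zeros of `ω`,
  where the printed direction is undefined). In Theorem 2 the supremum ranges over `y ∈ B(x, 2R)`
  with `x ∈ B(x₀, 2R)`, i.e. over `B(x₀, 4R)`; so that only CLASSICAL vorticity directions enter,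
  we record the theorem for `u` smooth on `(t₀ − (2R)², t₀) × B(x₀, 4R)` (a special case of the
  printed `Q_{2R}`). -- TODO(general form): smoothness on `Q_{2R}` only.
* The classes are recorded with lower Lebesgue integrals:
  Theorem 1: `∫⁻_{t₀−(2R)²}^{t₀} (∫⁻_{B(x₀,2R)} ‖ω‖ₑ^q)^{2/(2q−3)} < ∞` (= `‖ω‖_{L^q}^{2q/(2q−3)} ∈ L¹`)
  for real `3 ≤ q` (-- TODO(general form): the end-point `q = ∞`, the local BKM criterion);
  Theorem 2: `∫⁻ (∫⁻_{B(x₀,2R)} ‖ω‖ₑ^α ρ_{γ,2R}^α)^δ < ∞`.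

## References

* Z. Grujić, R. Guberović, Comm. Math. Phys. 298 (2010) 407–418, doi:10.1007/s00220-010-1000-4:
  (2)–(7) (pp. 408–410), Rmk. 1 (p. 411), Thm. 1 (p. 413), Thm. 2 (p. 415). [GrujicGuberovic2010]
* Z. Grujić, Comm. Math. Phys. 290 (2009) 861–870, Thm. 1 (tree `grujic2009_localized_halfHolder_coherence`).
  [Grujic2009]
* H. Beirão da Veiga, Chinese Ann. Math. B 16 (1995) 407–412 (the classes (2); tree
  `BeiraoDaVeiga1995_vorticityCriterion`). [BeiraoDaVeiga1995]
-/

noncomputable section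

open MeasureTheory Set Function Filter Metric
open scoped ENNReal
open _root_.Topology

namespace Literature.Analysis.FluidPDE

namespace GrujicGuberovic2010

/-- **Grujić–Guberović's `γ`-Hölder measure of coherence of the vorticity direction**
`ρ_{γ,r}(x, t) = sup_{y ∈ B(x,r), y ≠ x} |sin φ(ξ(x,t), ξ(y,t))| / |x − y|^γ` (p. 410), with
`ξ = ω/|ω|`, `ω = curl u(t,·)`, the sine rendered sign-blindly as `‖ξ(x,t) × ξ(y,t)‖`; valued in
`ℝ≥0∞` (`0` if the ball is trivial). [cite: GrujicGuberovic2010, §1 p. 410 and §4 p. 415 (definition of `ρ_{γ,r}`)] -/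
def coherenceQuotient (γ r : ℝ) (u : ℝ → EuclideanSpace ℝ (Fin 3) → EuclideanSpace ℝ (Fin 3))
    (t : ℝ) (x : EuclideanSpace ℝ (Fin 3)) : ℝ≥0∞ :=
  ⨆ (y : EuclideanSpace ℝ (Fin 3)) (_ : y ∈ ball x r) (_ : y ≠ x),
    ENNReal.ofReal
      (‖cross (vorticityDirection (curl (u t)) x) (vorticityDirection (curl (u t)) y)‖ / ‖x - y‖ ^ γ)

/-- A uniform bound on the Hölder quotients bounds `ρ_{γ,r}(x,t)`: in particular a `γ`-Hölder
(sign-blind) coherence `‖ξ(x,t) × ξ(y,t)‖ ≤ K|x − y|^γ` on `B(x, r)` gives `ρ_{γ,r}(x,t) ≤ K`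
(definition of the supremum). [cite: GrujicGuberovic2010, §1 p. 410] -/
theorem coherenceQuotient_le_of_bound {γ r K : ℝ}
    {u : ℝ → EuclideanSpace ℝ (Fin 3) → EuclideanSpace ℝ (Fin 3)} {t : ℝ}
    {x : EuclideanSpace ℝ (Fin 3)}
    (h : ∀ y ∈ ball x r, y ≠ x →
      ‖cross (vorticityDirection (curl (u t)) x) (vorticityDirection (curl (u t)) y)‖ ≤
        K * ‖x - y‖ ^ γ) :
    coherenceQuotient γ r u t x ≤ ENNReal.ofReal K := by
  refine iSup_le fun y => iSup_le fun hy => iSup_le fun hyx => ENNReal.ofReal_le_ofReal ?_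
  have hpos : 0 < ‖x - y‖ ^ γ := Real.rpow_pos_of_pos (norm_pos_iff.2 (sub_ne_zero.2 hyx.symm)) γ
  rw [div_le_iff₀ hpos]
  exact h y hy hyx

end GrujicGuberovic2010

/-- **Grujić–Guberović 2010, Theorem 1 (localized vorticity-magnitude criteria
`‖ω‖_{L^q(B(x₀,2R))}^{2q/(2q−3)} ∈ L¹(t₀ − (2R)², t₀)`, `3 ≤ q < ∞`).** Let `u` be a Leray–Hopf weak
solution of the unforced Navier–Stokes equations (`ν = 1`) on `ℝ³ × [0, T)` from `u₀`, let `x₀` be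
a point, `0 < R < 1` and `(2R)² ≤ t₀ < T` (so `Q_{2R}(x₀, t₀) ⊆ ℝ³ × (0, T)`), and let `3 ≤ q`.
Suppose `u` is smooth on the open backward cylinder `Q_{2R}(x₀, t₀)` and
`∫_{t₀−(2R)²}^{t₀} (∫_{B(x₀,2R)} |ω(x,t)|^q dx)^{2/(2q−3)} dt < ∞`. Then the localized enstrophy
stays bounded up to `t = t₀`: `sup_{t ∈ (t₀−R², t₀)} ∫_{B(x₀,R)} |ω|² dx < ∞`. (The global classes
are Beirão da Veiga's (2), tree `BeiraoDaVeiga1995_vorticityCriterion`; the printed end-point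
`q = ∞` — a local Beale–Kato–Majda criterion — is not recorded.) Not proved here; users take
`(h : grujicGuberovic2010_localized_vorticity_criterion)`.
-- TODO(general form): `q = ∞`.
[cite: GrujicGuberovic2010, Thm. 1 (p. 413) with (2) (p. 408)] -/
def grujicGuberovic2010_localized_vorticity_criterion : Prop :=
  ∀ ⦃T : ℝ⦄, 0 < T →
    ∀ ⦃u₀ : EuclideanSpace ℝ (Fin 3) → EuclideanSpace ℝ (Fin 3)⦄
      ⦃u : ℝ → EuclideanSpace ℝ (Fin 3) → EuclideanSpace ℝ (Fin 3)⦄,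
    IsLerayHopfOn T 1 0 u₀ u →
    ∀ (x₀ : EuclideanSpace ℝ (Fin 3)) (t₀ R q : ℝ), 0 < R → R < 1 → (2 * R) ^ 2 ≤ t₀ → t₀ < T →
      3 ≤ q →
    ContDiffOn ℝ (⊤ : ℕ∞) (uncurry u) (Ioo (t₀ - (2 * R) ^ 2) t₀ ×ˢ ball x₀ (2 * R)) →
    (∫⁻ t in Ioo (t₀ - (2 * R) ^ 2) t₀,
        (∫⁻ x in ball x₀ (2 * R), ‖curl (u t) x‖ₑ ^ q) ^ (2 / (2 * q - 3)) < ∞) →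
    ∃ C : ℝ, ∀ t ∈ Ioo (t₀ - R ^ 2) t₀, ∫ x in ball x₀ R, ‖curl (u t) x‖ ^ 2 ≤ C

/-- **Grujić–Guberović 2010, Theorem 2 (a local critical class in which the coherence of the
vorticity direction weights the integrability of its magnitude).** Let `u` be a Leray–Hopf weak
solution of the unforced Navier–Stokes equations (`ν = 1`) on `ℝ³ × [0, T)` from `u₀`, `x₀` a point,
`0 < R < 1`, `(2R)² ≤ t₀ < T`; let `0 < γ < 1`, `3/(γ + 2) < α < 3/γ` and `δ = 2/((2 + γ)α − 3)`
(scaling invariance). Suppose `u` is smooth on `(t₀ − (2R)², t₀) × B(x₀, 4R)` (printed: on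
`Q_{2R}(x₀, t₀)`; see the module docstring) and
`∫_{t₀−(2R)²}^{t₀} (∫_{B(x₀,2R)} |ω(x,t)|^α ρ_{γ,2R}(x,t)^α dx)^δ dt < ∞`, where
`ρ_{γ,2R}(x,t) = sup_{y ∈ B(x,2R), y ≠ x} |sin φ(ξ(x,t), ξ(y,t))|/|x − y|^γ`
(`GrujicGuberovic2010.coherenceQuotient`). Then the localized enstrophy stays bounded up to
`t = t₀`: `sup_{t ∈ (t₀−R², t₀)} ∫_{B(x₀,R)} |ω|² dx < ∞`. The end-point `γ = ½`, `α = 2`, `δ = 1`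
("an improvement over the `½`-Hölder coherence") is included. Not proved here; users take
`(h : grujicGuberovic2010_coherenceWeighted_criterion)`.
-- TODO(general form): smoothness on `Q_{2R}(x₀, t₀)` only.
[cite: GrujicGuberovic2010, Thm. 2 (p. 415) with (5)–(7) (p. 410)] -/
def grujicGuberovic2010_coherenceWeighted_criterion : Prop :=
  ∀ ⦃T : ℝ⦄, 0 < T →
    ∀ ⦃u₀ : EuclideanSpace ℝ (Fin 3) → EuclideanSpace ℝ (Fin 3)⦄
      ⦃u : ℝ → EuclideanSpace ℝ (Fin 3) → EuclideanSpace ℝ (Fin 3)⦄,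
    IsLerayHopfOn T 1 0 u₀ u →
    ∀ (x₀ : EuclideanSpace ℝ (Fin 3)) (t₀ R γ α : ℝ), 0 < R → R < 1 → (2 * R) ^ 2 ≤ t₀ → t₀ < T →
      0 < γ → γ < 1 → 3 / (γ + 2) < α → α < 3 / γ →
    ContDiffOn ℝ (⊤ : ℕ∞) (uncurry u) (Ioo (t₀ - (2 * R) ^ 2) t₀ ×ˢ ball x₀ (4 * R)) →
    (∫⁻ t in Ioo (t₀ - (2 * R) ^ 2) t₀,
        (∫⁻ x in ball x₀ (2 * R),
            ‖curl (u t) x‖ₑ ^ α *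
              GrujicGuberovic2010.coherenceQuotient γ (2 * R) u t x ^ α) ^
          (2 / ((2 + γ) * α - 3)) < ∞) →
    ∃ C : ℝ, ∀ t ∈ Ioo (t₀ - R ^ 2) t₀, ∫ x in ball x₀ R, ‖curl (u t) x‖ ^ 2 ≤ C

end Literature.Analysis.FluidPDE

end
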